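import Literature.Analysis.PDE.ChartOperator
import Literature.Analysis.PDE.TameCalculus
import HarnessLib

/-!
# The localised operator on classical (finitely smooth) tuples, and its Lipschitz structure

Analytic layer of the energy-method programme for short-time existence of quasilinear strictly
parabolic second-order systems on a closed manifold (hypothesis `hQL` of
`Literature.Geometry.Riemannian.ricciFlow_shortTime_existence_of_quasilinear`; Hamilton 1982,
§5; Taylor, *PDE III*, Ch. 15, §7). The compactly supported part `Fop k U` of the diagonal
localised operator (`ChartOperator.lean`) is defined on the Sobolev tuple spaces through the
evaluation functionals. For the **uniqueness** of classical solutions (the standard `L²` energy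
argument, Evans, *PDE*, §7.1.2, Thm. 4, transported to the quasilinear setting as in Taylor,
Ch. 15, §7, Prop. 7.3) one needs the same operator as a function of a tuple
`r : Fin N → ℝⁿ → W` of `C²` maps, together with its Lipschitz dependence on `r`. This file
provides:

* finite-smoothness versions of the word-derivative calculus of the transfer operator
  (`contDiff_cwd_of_le`, `TransferData.cwd_transfer_of_contDiff`, `norm_cwd_transfer_le'`);
* `gR k r = Σ_j m_{kj} · r_j ∘ τ_{kj}` (classical reconstruction), its jet
  `jetR k r = (gR, (∂ᵢ gR)ᵢ)`, the correction `ellR` and the operator `FopR k r`, with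
  `Fop k U = FopR k (rep U)` on `𝐇_s`, `dim + 2 ≤ s` (`Fop_eq_FopR`);
* uniform jet bounds (`exists_cwd_gR_bound`, `norm_jetR_le`), the `C¹` regularity and the uniform bounds of the
  frozen principal coefficient `y ↦ a_k(y, jetR k r y)` (`exists_aField_bounds`);
* the **Lipschitz structure**
  `‖FopR k r₁ − FopR k r₂ − Σ b^{ii'}(y, jetR k r₁ y) ∂_{ii'}(r₁ₖ − r₂ₖ)‖ ≤ C · J(r₁ − r₂)(y)`,
  `J(D)(y) = ‖gR k D y‖ + Σᵢ ‖∂ᵢ gR k D y‖`, with `C` depending only on the chart data and on a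
  sup bound of the derivatives of order `≤ 2` of `r₁, r₂` on the ball (`exists_FopR_lipschitz`);
* the `L²` bound `‖𝟙_B J(D)‖_{L²} ≤ C Σ_j (‖D_j‖_{L²} + Σ_l ‖∂_l D_j‖_{L²})` (`exists_l2On_jet_le`).

Everything is proved; no named fact and no `sorry` is introduced.

## References

* L. C. Evans, *Partial differential equations*, 2nd ed., AMS 2010, §7.1.2 (Thm. 4, uniqueness by
  the energy method), §5.6.3. [Evans2010]
* M. E. Taylor, *Partial differential equations III*, 2nd ed., Springer 2011, Ch. 15, §7.
  [TaylorPDEIII2011]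
* R. A. Adams, *Sobolev spaces*, Academic Press 1975, Thm. 3.35 (change of variables).
  [Adams1975]
-/

noncomputable section

open MeasureTheory Set Function Filter Metric
open scoped ContDiff Topology RealInnerProductSpace ENNReal NNReal

namespace Literature.Analysis.PDE

open Literature.Analysis.FunctionSpaces

variable {ι : Type*} [Fintype ι] [DecidableEq ι]

section FiniteSmooth

variable {F : Type*} [NormedAddCommGroup F] [NormedSpace ℝ F]

/-! ### Word derivatives of finitely smooth maps -/

omit [DecidableEq ι] in
/-- `∂_v f ∈ C^m` when `f ∈ C^n` and `|v| + m ≤ n`. [folklore] -/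
theorem contDiff_cwd_of_le {f : EuclideanSpace ℝ ι → F} {n : ℕ} (hf : ContDiff ℝ n f) :
    ∀ (v : List ι) (m : ℕ), v.length + m ≤ n → ContDiff ℝ m (cwd v f)
  | [], m, h => by
    rw [cwd_nil]
    exact hf.of_le (by exact_mod_cast (by simpa using h))
  | i :: v, m, h => by
    have ih := contDiff_cwd_of_le hf v (m + 1) (by simp at h; omega)
    rw [cwd_cons]
    exact (ih.fderiv_right (m := m) (by push_cast; exact le_rfl)).clm_apply contDiff_const

omit [DecidableEq ι] in
/-- `∂_v f` is differentiable when `f ∈ C^n` and `|v| + 1 ≤ n`. [folklore] -/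
theorem differentiable_cwd_of_le {f : EuclideanSpace ℝ ι → F} {n : ℕ} (hf : ContDiff ℝ n f)
    (v : List ι) (h : v.length + 1 ≤ n) : Differentiable ℝ (cwd v f) :=
  (contDiff_cwd_of_le hf v 1 h).differentiable one_ne_zero

omit [DecidableEq ι] in
/-- `∂_v f` is continuous when `f ∈ C^n` and `|v| ≤ n`. [folklore] -/
theorem continuous_cwd_of_le {f : EuclideanSpace ℝ ι → F} {n : ℕ} (hf : ContDiff ℝ n f)
    (v : List ι) (h : v.length ≤ n) : Continuous (cwd v f) :=
  (contDiff_cwd_of_le hf v 0 (by simpa using h)).continuous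

omit [DecidableEq ι] in
/-- `∂_v (f - g) = ∂_v f - ∂_v g` for `f, g ∈ C^n`, `|v| ≤ n`. [folklore] -/
theorem cwd_sub_of_le {f g : EuclideanSpace ℝ ι → F} {n : ℕ} (hf : ContDiff ℝ n f)
    (hg : ContDiff ℝ n g) :
    ∀ v : List ι, v.length ≤ n → cwd v (f - g) = cwd v f - cwd v g
  | [], _ => rfl
  | i :: v, h => by
    have h' : v.length + 1 ≤ n := by simpa using h
    have ih := cwd_sub_of_le hf hg v (by omega)
    funext x
    rw [cwd_cons, ih]
    change fderiv ℝ (cwd v f - cwd v g) x (bv i) = _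
    rw [fderiv_sub ((differentiable_cwd_of_le hf v h') x) ((differentiable_cwd_of_le hg v h') x)]
    rfl

omit [DecidableEq ι] in
/-- `∂_v (Σ_j f_j) = Σ_j ∂_v f_j` for finitely many `f_j ∈ C^n`, `|v| ≤ n`. [folklore] -/
theorem cwd_finset_sum_of_le {κ : Type*} (S : Finset κ) {f : κ → EuclideanSpace ℝ ι → F} {n : ℕ}
    (hf : ∀ j ∈ S, ContDiff ℝ n (f j)) :
    ∀ v : List ι, v.length ≤ n → cwd v (fun x => ∑ j ∈ S, f j x) = fun x => ∑ j ∈ S, cwd v (f j) x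
  | [], _ => rfl
  | i :: v, h => by
    have h' : v.length + 1 ≤ n := by simpa using h
    have ih := cwd_finset_sum_of_le S hf v (by omega)
    funext x
    rw [cwd_cons, ih]
    have hd : ∀ j ∈ S, DifferentiableAt ℝ (cwd v (f j)) x := fun j hj =>
      (differentiable_cwd_of_le (hf j hj) v h') x
    rw [show (fun x => ∑ j ∈ S, cwd v (f j) x) = ∑ j ∈ S, cwd v (f j) from by funext y; simp]
    change fderiv ℝ (∑ j ∈ S, cwd v (f j)) x (bv i) = _
    rw [fderiv_sum hd]
    simp

end FiniteSmooth

/-! ### The transfer of finitely smooth maps -/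

namespace TransferData

variable {F : Type*} [NormedAddCommGroup F] [NormedSpace ℝ F]
variable (D : TransferData ι)

omit [DecidableEq ι] in
/-- The chain rule for one (coefficient, word) pair inside `Ω`, for `∂_w u` differentiable.
[folklore] -/
theorem fderiv_coef_smul_cwd_comp' {u : EuclideanSpace ℝ ι → F} (w : List ι)
    (hcw : Differentiable ℝ (cwd w u)) {c : EuclideanSpace ℝ ι → ℝ} (hc : ContDiff ℝ ∞ c)
    {x : EuclideanSpace ℝ ι} (hx : x ∈ D.Ω) (i : ι) :
    fderiv ℝ (fun y => c y • cwd w u (D.τ y)) x (bv i) =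
      fderiv ℝ c x (bv i) • cwd w u (D.τ x) +
        ∑ l : ι, (c x * (fderiv ℝ D.τ x (bv i)) l) • cwd (l :: w) u (D.τ x) := by
  classical
  have hτ : DifferentiableAt ℝ D.τ x :=
    (D.contDiffOn_τ.differentiableOn (by simp)).differentiableAt (D.isOpen_Ω.mem_nhds hx)
  have hcw' : DifferentiableAt ℝ (cwd w u) (D.τ x) := hcw _
  have hcomp : DifferentiableAt ℝ (fun y => cwd w u (D.τ y)) x := hcw'.comp x hτ
  have hc' : DifferentiableAt ℝ c x := (hc.differentiable (by simp)) x
  rw [fderiv_fun_smul hc' hcomp]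
  simp only [_root_.add_apply, _root_.smul_apply, ContinuousLinearMap.smulRight_apply, add_comm]
  congr 1
  have hchain : fderiv ℝ (fun y => cwd w u (D.τ y)) x (bv i) =
      fderiv ℝ (cwd w u) (D.τ x) (fderiv ℝ D.τ x (bv i)) := by
    rw [show (fun y => cwd w u (D.τ y)) = cwd w u ∘ D.τ from rfl, fderiv_comp x hcw' hτ]
    rfl
  rw [hchain]
  set e : EuclideanSpace ℝ ι := fderiv ℝ D.τ x (bv i) with he
  have he' : e = ∑ l, e l • (bv l : EuclideanSpace ℝ ι) := by
    simpa [bv_def] using ((EuclideanSpace.basisFun ι ℝ).sum_repr e).symm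
  conv_lhs => rw [he']
  rw [map_sum, Finset.smul_sum]
  refine Finset.sum_congr rfl fun l _ => ?_
  rw [map_smul, cwd_cons, smul_smul]

omit [DecidableEq ι] in
/-- Each chain-rule term of a `C^n` map with a word of length `< n` is `C¹`. [folklore] -/
theorem contDiff_one_tterm {u : EuclideanSpace ℝ ι → F} {n : ℕ} (hu : ContDiff ℝ n u)
    {v : List ι} (hv : v.length + 1 ≤ n) {p : (EuclideanSpace ℝ ι → ℝ) × List ι}
    (hp : p ∈ D.tterms v) : ContDiff ℝ 1 fun y => p.1 y • cwd p.2 u (D.τ y) := by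
  obtain ⟨hp1, hp2, hp3⟩ := D.tterms_spec v p hp
  have h1 : ContDiff ℝ 1 (cwd p.2 u) := contDiff_cwd_of_le hu p.2 1 (by omega)
  exact (contDiff_cutoff_smul D.isOpen_Ω (hp1.of_le (mod_cast le_top))
    (hp2.trans D.tsupport_m_subset) (h1.comp_contDiffOn (D.contDiffOn_τ.of_le (mod_cast le_top)))).1

omit [DecidableEq ι] in
/-- Each chain-rule term of a `C^n` map with a word of length `≤ n` is continuous. [folklore] -/
theorem continuous_tterm {u : EuclideanSpace ℝ ι → F} {n : ℕ} (hu : ContDiff ℝ n u)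
    {v : List ι} (hv : v.length ≤ n) {p : (EuclideanSpace ℝ ι → ℝ) × List ι}
    (hp : p ∈ D.tterms v) : Continuous fun y => p.1 y • cwd p.2 u (D.τ y) := by
  obtain ⟨hp1, hp2, hp3⟩ := D.tterms_spec v p hp
  have h1 : ContDiff ℝ 0 (cwd p.2 u) := contDiff_cwd_of_le hu p.2 0 (by omega)
  have h := (contDiff_cutoff_smul D.isOpen_Ω (hp1.of_le (mod_cast le_top))
    (hp2.trans D.tsupport_m_subset) (h1.comp_contDiffOn (D.contDiffOn_τ.of_le (mod_cast le_top)))).1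
  exact h.continuous

omit [DecidableEq ι] in
/-- **The chain-rule structure of the transfer of a `C^n` map**: for `|v| ≤ n`,
`∂_v (m · u ∘ τ)(x) = Σ_{(c, w) ∈ tterms v} c(x) · (∂_w u)(τ x)`. [cite: Adams1975, Thm. 3.35] -/
theorem cwd_transfer_of_contDiff {u : EuclideanSpace ℝ ι → F} {n : ℕ} (hu : ContDiff ℝ n u) :
    ∀ v : List ι, v.length ≤ n → cwd v (transfer D.m D.τ u) =
      fun x => ((D.tterms v).map fun p => p.1 x • cwd p.2 u (D.τ x)).sum
  | [], _ => by funext x; simp [tterms, transfer]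
  | i :: v, hv => by
    have hv' : v.length + 1 ≤ n := by simpa using hv
    have ih := cwd_transfer_of_contDiff hu v (by omega)
    funext x
    rw [cwd_cons]
    change fderiv ℝ (cwd v (transfer D.m D.τ u)) x (bv i) = _
    rw [ih]
    simp only [tterms]
    rw [sum_map_flatMap]
    have hdiff : ∀ p ∈ D.tterms v, Differentiable ℝ (fun y => p.1 y • cwd p.2 u (D.τ y)) :=
      fun p hp => (D.contDiff_one_tterm hu hv' hp).differentiable one_ne_zero
    rw [fderiv_list_sum_map_apply (D.tterms v) hdiff x (bv i)]
    congr 1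
    refine List.map_congr_left fun p hp => ?_
    rw [D.sum_map_tstep]
    obtain ⟨hp1, _, hp3⟩ := D.tterms_spec v p hp
    by_cases hx : x ∈ D.Ω
    · exact D.fderiv_coef_smul_cwd_comp' p.2 (differentiable_cwd_of_le hu p.2 (by omega)) hp1 hx i
    · have hxm : x ∉ tsupport D.m := fun h => hx (D.tsupport_m_subset h)
      have hp0 : p.1 =ᶠ[𝓝 x] 0 := D.coef_eventuallyEq_zero hp hxm
      have hterm0 : (fun y => p.1 y • cwd p.2 u (D.τ y)) =ᶠ[𝓝 x] fun _ => 0 := by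
        filter_upwards [hp0] with y hy
        simp [hy]
      rw [hterm0.fderiv_eq, show fderiv ℝ (fun _ : EuclideanSpace ℝ ι => (0 : F)) x = 0 from
        fderiv_const_apply 0]
      have h1 : fderiv ℝ p.1 x (bv i) = 0 := by
        rw [hp0.fderiv_eq, show fderiv ℝ (0 : EuclideanSpace ℝ ι → ℝ) x = 0 from
          congrFun fderiv_zero x]
        rfl
      have h2 : p.1 x = 0 := hp0.eq_of_nhds
      simp [h1, h2]

omit [DecidableEq ι] in
/-- **Pointwise bound for the transfer of a `C^n` map**, `|v| ≤ n`:
`‖∂_v (m · u ∘ τ)(x)‖ ≤ Σ_{(c,w)} |c x| ‖∂_w u (τ x)‖`. [folklore] -/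
theorem norm_cwd_transfer_le' {u : EuclideanSpace ℝ ι → F} {n : ℕ} (hu : ContDiff ℝ n u)
    (v : List ι) (hv : v.length ≤ n) (x : EuclideanSpace ℝ ι) :
    ‖cwd v (transfer D.m D.τ u) x‖ ≤
      ((D.tterms v).map fun p => |p.1 x| * ‖cwd p.2 u (D.τ x)‖).sum := by
  rw [D.cwd_transfer_of_contDiff hu v hv]
  refine (norm_list_sum_le _).trans ?_
  rw [List.map_map]
  refine List.sum_le_sum fun p _ => ?_
  simp [norm_smul]

omit [DecidableEq ι] in
/-- Finite differentiability of the transfer of a `C^n` map. [cite: Adams1975, Thm. 3.35] -/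
theorem contDiff_transfer_nat {u : EuclideanSpace ℝ ι → F} {n : ℕ} (hu : ContDiff ℝ n u) :
    ContDiff ℝ n (transfer D.m D.τ u) :=
  D.contDiff_transfer_of_le (mod_cast le_top) hu

omit [DecidableEq ι] in
/-- If a coefficient of a chain-rule term does not vanish at `x`, then `τ x ∈ τ '' tsupport m`.
[folklore] -/
theorem apply_mem_image_of_coef_ne_zero {v : List ι} {p : (EuclideanSpace ℝ ι → ℝ) × List ι}
    (hp : p ∈ D.tterms v) {x : EuclideanSpace ℝ ι} (hx : p.1 x ≠ 0) :
    D.τ x ∈ D.τ '' tsupport D.m :=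
  ⟨x, (D.tterms_spec v p hp).2.1 (subset_tsupport _ (mem_support.2 hx)), rfl⟩

omit [DecidableEq ι] in
/-- **Uniform bound of a chain-rule sum**: if `|c| ≤ M` for all coefficients and
`‖∂_w u (τ x)‖ ≤ A` whenever `τ x ∈ τ '' tsupport m` and `|w| ≤ |v|`, then
`Σ |c x| ‖∂_w u(τ x)‖ ≤ (#terms) · M · A`. [folklore] -/
theorem sum_tterms_le {u : EuclideanSpace ℝ ι → F} (v : List ι) {M A : ℝ} (hA : 0 ≤ A)
    (hM : ∀ p ∈ D.tterms v, ∀ x, |p.1 x| ≤ M)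
    (hu : ∀ w : List ι, w.length ≤ v.length → ∀ z ∈ D.τ '' tsupport D.m, ‖cwd w u z‖ ≤ A)
    (x : EuclideanSpace ℝ ι) :
    ((D.tterms v).map fun p => |p.1 x| * ‖cwd p.2 u (D.τ x)‖).sum ≤
      (D.tterms v).length * (M * A) := by
  have h : ∀ p ∈ D.tterms v, |p.1 x| * ‖cwd p.2 u (D.τ x)‖ ≤ M * A := by
    intro p hp
    by_cases h0 : p.1 x = 0
    · rw [h0, abs_zero, zero_mul]
      exact mul_nonneg ((abs_nonneg _).trans (hM p hp x)) hA
    · exact mul_le_mul (hM p hp x) (hu p.2 (D.tterms_spec v p hp).2.2 _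
        (D.apply_mem_image_of_coef_ne_zero hp h0)) (norm_nonneg _) ((abs_nonneg _).trans (hM p hp x))
  have := List.sum_le_card_nsmul ((D.tterms v).map fun p => |p.1 x| * ‖cwd p.2 u (D.τ x)‖) (M * A)
    (fun y hy => by
      obtain ⟨p, hp, rfl⟩ := List.mem_map.1 hy
      exact h p hp)
  simpa [nsmul_eq_mul] using this

end TransferData

/-! ### The localised operator on classical tuples -/

namespace ChartData

variable {W : Type*} [NormedAddCommGroup W] [InnerProductSpace ℝ W] [CompleteSpace W]
variable {N : ℕ} (𝒟 : ChartData ι W N)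

/-- **Classical reconstruction** `gR k r = Σ_j m_{kj} · r_j ∘ τ_{kj}` of a tuple of maps.
[cite: TaylorPDEIII2011, Ch. 15, §7] -/
def gR (k : Fin N) (r : Fin N → EuclideanSpace ℝ ι → W) : EuclideanSpace ℝ ι → W :=
  fun y => ∑ j, transfer (𝒟.T k j).m (𝒟.T k j).τ (r j) y

/-- **The first-order jet of the classical reconstruction** `(gR, (∂ᵢ gR)ᵢ)`. [folklore] -/
def jetR (k : Fin N) (r : Fin N → EuclideanSpace ℝ ι → W) : EuclideanSpace ℝ ι → W × (ι → W) :=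
  fun y => (𝒟.gR k r y, fun i => cwd [i] (𝒟.gR k r) y)

/-- **The lower-order correction on classical tuples** (cf. `ell`). [cite: TaylorPDEIII2011, Ch. 15, §7] -/
def ellR (k : Fin N) (r : Fin N → EuclideanSpace ℝ ι → W) : EuclideanSpace ℝ ι → W := fun y =>
  -(∑ i, ∑ i', 𝒟.a k (y, 𝒟.jetR k r y) i i' •
      ((fderiv ℝ (𝒟.α k) y (bv i)) • cwd [i'] (𝒟.gR k r) y +
        (fderiv ℝ (𝒟.α k) y (bv i')) • cwd [i] (𝒟.gR k r) y +
        (cwd [i, i'] (𝒟.α k) y) • 𝒟.gR k r y)) +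
    (𝒟.α k y) • 𝒟.f k (y, 𝒟.jetR k r y)

/-- **The compactly supported part of the localised operator on classical tuples** (cf. `Fop`):
`FopR k r = Σ b^{ii'}(y, jetR k r) ∂_{ii'} r_k + ellR k r`. [cite: TaylorPDEIII2011, Ch. 15, §7] -/
def FopR (k : Fin N) (r : Fin N → EuclideanSpace ℝ ι → W) : EuclideanSpace ℝ ι → W := fun y =>
  (∑ i, ∑ i', 𝒟.b k (y, 𝒟.jetR k r y) i i' • cwd [i, i'] (r k) y) + 𝒟.ellR k r y

variable {n : ℕ}

omit [CompleteSpace W] in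
/-- `gR k r ∈ C^n` for a `C^n` tuple. [cite: Adams1975, Thm. 3.35] -/
theorem contDiff_gR (k : Fin N) {r : Fin N → EuclideanSpace ℝ ι → W} (hr : ∀ j, ContDiff ℝ n (r j)) :
    ContDiff ℝ n (𝒟.gR k r) :=
  ContDiff.sum fun j _ => (𝒟.T k j).contDiff_transfer_nat (hr j)

omit [CompleteSpace W] in
/-- Word derivatives of `gR` are sums of word derivatives of the transfers (`|v| ≤ n`). [folklore] -/
theorem cwd_gR (k : Fin N) {r : Fin N → EuclideanSpace ℝ ι → W} (hr : ∀ j, ContDiff ℝ n (r j))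
    (v : List ι) (hv : v.length ≤ n) :
    cwd v (𝒟.gR k r) = fun y => ∑ j, cwd v (transfer (𝒟.T k j).m (𝒟.T k j).τ (r j)) y :=
  cwd_finset_sum_of_le Finset.univ (fun j _ => (𝒟.T k j).contDiff_transfer_nat (hr j)) v hv

omit [CompleteSpace W] in
/-- `gR` is additive in the tuple (pointwise, no regularity needed). [folklore] -/
theorem gR_sub (k : Fin N) (r₁ r₂ : Fin N → EuclideanSpace ℝ ι → W) :
    𝒟.gR k (r₁ - r₂) = 𝒟.gR k r₁ - 𝒟.gR k r₂ := by
  funext y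
  simp only [gR, Pi.sub_apply, transfer_apply, smul_sub, Finset.sum_sub_distrib]

omit [CompleteSpace W] in
/-- First derivatives of `gR` are additive in the tuple (`C¹` tuples). [folklore] -/
theorem cwd_gR_sub (k : Fin N) {r₁ r₂ : Fin N → EuclideanSpace ℝ ι → W} {n : ℕ}
    (hr₁ : ∀ j, ContDiff ℝ n (r₁ j)) (hr₂ : ∀ j, ContDiff ℝ n (r₂ j)) (v : List ι) (hv : v.length ≤ n) :
    cwd v (𝒟.gR k (r₁ - r₂)) = cwd v (𝒟.gR k r₁) - cwd v (𝒟.gR k r₂) := by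
  rw [𝒟.gR_sub, cwd_sub_of_le (𝒟.contDiff_gR k hr₁) (𝒟.contDiff_gR k hr₂) v hv]

omit [CompleteSpace W] in
/-- `jetR` is additive in the tuple (`C¹` tuples). [folklore] -/
theorem jetR_sub (k : Fin N) {r₁ r₂ : Fin N → EuclideanSpace ℝ ι → W} {n : ℕ}
    (hr₁ : ∀ j, ContDiff ℝ n (r₁ j)) (hr₂ : ∀ j, ContDiff ℝ n (r₂ j)) (hn : 1 ≤ n) (y : EuclideanSpace ℝ ι) :
    𝒟.jetR k (r₁ - r₂) y = 𝒟.jetR k r₁ y - 𝒟.jetR k r₂ y := by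
  simp only [jetR, Prod.mk_sub_mk, 𝒟.gR_sub, Pi.sub_apply]
  congr 1
  funext i
  rw [← 𝒟.gR_sub, 𝒟.cwd_gR_sub k hr₁ hr₂ [i] (by simpa using hn)]
  rfl

/-! ### Agreement with the operator on the Sobolev tuple space -/

variable {s : ℕ}

/-- `ghat k U = gR k (rep U)` (definitional). [folklore] -/
theorem ghat_eq_gR (k : Fin N) (U : Hs W N s ι) : 𝒟.ghat k U = 𝒟.gR k (fun j => Hs.rep j U) := rfl

/-- **`dghat` is the derivative of the reconstruction of the representatives** (`dim + 2 ≤ s`).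
[folklore] -/
theorem dghat_eq_cwd_gR (hs : Fintype.card ι + 2 ≤ s) (k : Fin N) (U : Hs W N s ι) (i : ι) :
    𝒟.dghat k U i = cwd [i] (𝒟.gR k (fun j => Hs.rep j U)) := by
  have hr : ∀ j, ContDiff ℝ 2 (Hs.rep j U) := fun j => contDiff_rep (m := 2) U (by omega)
  rw [𝒟.cwd_gR k hr [i] (by simp)]
  funext y
  simp only [dghat]
  refine Finset.sum_congr rfl fun j _ => ?_
  have h := congrFun ((𝒟.T k j).cwd_transfer_of_contDiff (hr j) [i] (by simp)) y
  rw [h]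
  simp only [TransferData.tterms, List.flatMap_cons, List.flatMap_nil, List.append_nil,
    (𝒟.T k j).sum_map_tstep, cwd_nil]
  congr 1
  rw [Finset.smul_sum]
  refine Finset.sum_congr rfl fun l _ => ?_
  rw [cwd_rep (k := j) U [l] (by simp; omega), smul_smul]
  rfl

/-- **`jet1 k U = jetR k (rep U)`** (`dim + 2 ≤ s`). [folklore] -/
theorem jet1_eq_jetR (hs : Fintype.card ι + 2 ≤ s) (k : Fin N) (U : Hs W N s ι) :
    𝒟.jet1 k U = 𝒟.jetR k (fun j => Hs.rep j U) := by
  funext y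
  simp only [jet1, jetR, 𝒟.dghat_eq_cwd_gR hs]
  rfl

/-- **`ell k U = ellR k (rep U)`** (`dim + 2 ≤ s`). [folklore] -/
theorem ell_eq_ellR (hs : Fintype.card ι + 2 ≤ s) (k : Fin N) (U : Hs W N s ι) :
    𝒟.ell k U = 𝒟.ellR k (fun j => Hs.rep j U) := by
  funext y
  simp only [ell, ellR, 𝒟.jet1_eq_jetR hs, 𝒟.dghat_eq_cwd_gR hs]
  rfl

/-- **`Fop k U = FopR k (rep U)`**: on `𝐇_s`, `dim + 2 ≤ s`, the operator is the classical
operator of the representatives. [folklore] -/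
theorem Fop_eq_FopR (hs : Fintype.card ι + 2 ≤ s) (k : Fin N) (U : Hs W N s ι) :
    𝒟.Fop k U = 𝒟.FopR k (fun j => Hs.rep j U) := by
  have hev : ∀ (i i' : ι) (y : EuclideanSpace ℝ ι), Hs.ev k [i, i'] y U = cwd [i, i'] (Hs.rep k U) y := by
    intro i i' y
    rw [cwd_rep (k := k) U [i, i'] (by simp; omega)]
    rfl
  funext y
  simp only [Fop, FopR, 𝒟.jet1_eq_jetR hs, 𝒟.ell_eq_ellR hs, hev]

/-! ### Support -/

omit [CompleteSpace W] in
/-- Outside the ball, `ellR` vanishes. [folklore] -/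
theorem ellR_eq_zero (k : Fin N) (r : Fin N → EuclideanSpace ℝ ι → W) {y : EuclideanSpace ℝ ι}
    (hy : 𝒟.R ≤ ‖y‖) : 𝒟.ellR k r y = 0 := by
  have hyα : y ∉ tsupport (𝒟.α k) := fun h => by
    have := 𝒟.tsupport_α k h
    rw [mem_ball, dist_zero_right] at this
    linarith
  have h0 : 𝒟.α k y = 0 := image_eq_zero_of_notMem_tsupport hyα
  have h1 : ∀ i, fderiv ℝ (𝒟.α k) y (bv i) = 0 := fun i => by
    have : y ∉ tsupport (fun y => fderiv ℝ (𝒟.α k) y (bv i)) := fun h =>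
      hyα (tsupport_fderiv_apply_subset ℝ (bv i) h)
    exact image_eq_zero_of_notMem_tsupport (f := fun y => fderiv ℝ (𝒟.α k) y (bv i)) this
  have h2 : ∀ i i', cwd [i, i'] (𝒟.α k) y = 0 := fun i i' => by
    have : y ∉ tsupport (cwd [i, i'] (𝒟.α k)) := fun h => hyα (tsupport_cwd_subset _ _ h)
    exact image_eq_zero_of_notMem_tsupport this
  simp only [ellR, h0, h1, h2, zero_smul, add_zero, smul_zero, Finset.sum_const_zero, neg_zero]

omit [CompleteSpace W] in
/-- **`FopR k r` vanishes outside the closed ball of radius `R`.** [folklore] -/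
theorem FopR_eq_zero (k : Fin N) (r : Fin N → EuclideanSpace ℝ ι → W) {y : EuclideanSpace ℝ ι}
    (hy : 𝒟.R ≤ ‖y‖) : 𝒟.FopR k r y = 0 := by
  simp only [FopR, 𝒟.b_eq_zero k y _ hy, 𝒟.ellR_eq_zero k r hy]
  simp

omit [CompleteSpace W] in
/-- Outside the ball, `gR` vanishes (all multipliers are supported in the ball). [folklore] -/
theorem gR_eq_zero (k : Fin N) (r : Fin N → EuclideanSpace ℝ ι → W) {y : EuclideanSpace ℝ ι}
    (hy : 𝒟.R ≤ ‖y‖) : 𝒟.gR k r y = 0 := by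
  simp only [gR, transfer_apply]
  refine Finset.sum_eq_zero fun j _ => ?_
  have : y ∉ tsupport (𝒟.T k j).m := fun h => by
    have := 𝒟.tsupport_m k j h
    rw [mem_ball, dist_zero_right] at this
    linarith
  rw [image_eq_zero_of_notMem_tsupport this, zero_smul]

end ChartData

/-! ### Generic estimates -/

section Generic

variable {W : Type*} [NormedAddCommGroup W] [NormedSpace ℝ W]

omit [DecidableEq ι] in
/-- `‖Σ a₁•X₁ − Σ a₂•X₂‖ ≤ Σ (|a₁ − a₂| ‖X₁‖ + |a₂| ‖X₁ − X₂‖)` for double sums. [folklore] -/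
theorem norm_sum_sum_smul_sub_le (a₁ a₂ : ι → ι → ℝ) (X₁ X₂ : ι → ι → W) :
    ‖(∑ i, ∑ i', a₁ i i' • X₁ i i') - ∑ i, ∑ i', a₂ i i' • X₂ i i'‖ ≤
      ∑ i, ∑ i', (|a₁ i i' - a₂ i i'| * ‖X₁ i i'‖ + |a₂ i i'| * ‖X₁ i i' - X₂ i i'‖) := by
  have h : (∑ i, ∑ i', a₁ i i' • X₁ i i') - ∑ i, ∑ i', a₂ i i' • X₂ i i' =
      ∑ i, ∑ i', ((a₁ i i' - a₂ i i') • X₁ i i' + a₂ i i' • (X₁ i i' - X₂ i i')) := by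
    rw [← Finset.sum_sub_distrib]
    refine Finset.sum_congr rfl fun i _ => ?_
    rw [← Finset.sum_sub_distrib]
    refine Finset.sum_congr rfl fun i' _ => ?_
    rw [sub_smul, smul_sub]; abel
  rw [h]
  refine (norm_sum_le _ _).trans (Finset.sum_le_sum fun i _ => (norm_sum_le _ _).trans
    (Finset.sum_le_sum fun i' _ => (norm_add_le _ _).trans ?_))
  rw [norm_smul, norm_smul, Real.norm_eq_abs, Real.norm_eq_abs]

omit [DecidableEq ι] in
/-- A double sum of terms bounded by `B` is at most `card² · B`. [folklore] -/
theorem sum_sum_le_card_sq_mul {T : ι → ι → ℝ} {B : ℝ} (h : ∀ i i', T i i' ≤ B) :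
    ∑ i, ∑ i', T i i' ≤ (Fintype.card ι : ℝ) ^ 2 * B := by
  calc ∑ i, ∑ i', T i i' ≤ ∑ _i : ι, ∑ _i' : ι, B :=
        Finset.sum_le_sum fun i _ => Finset.sum_le_sum fun i' _ => h i i'
    _ = (Fintype.card ι : ℝ) ^ 2 * B := by
        simp only [Finset.sum_const, Finset.card_univ, nsmul_eq_mul]; ring

/-- **Bounds of a `C¹` map on a closed ball of a finite-dimensional space**: a common bound `L`
for `‖φ‖`, `‖Dφ‖` and the Lipschitz constant on the ball (mean value inequality on a convex
compact set). [folklore] -/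
theorem exists_bounds_of_contDiff_one {E' G : Type*} [NormedAddCommGroup E'] [NormedSpace ℝ E']
    [FiniteDimensional ℝ E'] [NormedAddCommGroup G] [NormedSpace ℝ G] {φ : E' → G}
    (hφ : ContDiff ℝ 1 φ) (ρ : ℝ) :
    ∃ L : ℝ, 0 ≤ L ∧ (∀ z ∈ closedBall (0 : E') ρ, ‖φ z‖ ≤ L) ∧
      (∀ z ∈ closedBall (0 : E') ρ, ‖fderiv ℝ φ z‖ ≤ L) ∧
      ∀ z₁ ∈ closedBall (0 : E') ρ, ∀ z₂ ∈ closedBall (0 : E') ρ, ‖φ z₁ - φ z₂‖ ≤ L * ‖z₁ - z₂‖ := by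
  have hK : IsCompact (closedBall (0 : E') ρ) := isCompact_closedBall 0 ρ
  obtain ⟨B₀, hB₀⟩ := hK.exists_bound_of_continuousOn hφ.continuous.continuousOn
  obtain ⟨B₁, hB₁⟩ := hK.exists_bound_of_continuousOn (hφ.continuous_fderiv one_ne_zero).continuousOn
  set L : ℝ := max (max B₀ B₁) 0 with hL
  have hL0 : 0 ≤ L := le_max_right _ _
  have hB₀L : ∀ z ∈ closedBall (0 : E') ρ, ‖φ z‖ ≤ L := fun z hz =>
    (hB₀ z hz).trans ((le_max_left _ _).trans (le_max_left _ _))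
  have hB₁L : ∀ z ∈ closedBall (0 : E') ρ, ‖fderiv ℝ φ z‖ ≤ L := fun z hz =>
    (hB₁ z hz).trans ((le_max_right _ _).trans (le_max_left _ _))
  refine ⟨L, hL0, hB₀L, hB₁L, fun z₁ hz₁ z₂ hz₂ => ?_⟩
  exact (convex_closedBall (0 : E') ρ).norm_image_sub_le_of_norm_fderiv_le
    (fun z _ => (hφ.differentiable one_ne_zero).differentiableAt) hB₁L hz₂ hz₁

end Generic

namespace ChartData

variable {W : Type*} [NormedAddCommGroup W] [InnerProductSpace ℝ W] [CompleteSpace W]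
variable {N : ℕ} (𝒟 : ChartData ι W N)

/-! ### Uniform jet bounds -/

omit [CompleteSpace W] in
/-- **Uniform bound of the word derivatives of order `≤ 2` of the classical reconstruction** in
terms of a sup bound `A` of the derivatives of order `≤ 2` of the tuple on the closed ball:
`‖∂_v gR k r (y)‖ ≤ C A` for all `y`, with `C` depending on the chart data only. [folklore] -/
theorem exists_cwd_gR_bound (k : Fin N) :
    ∃ C : ℝ, 0 ≤ C ∧ ∀ (n : ℕ) (r : Fin N → EuclideanSpace ℝ ι → W), (∀ j, ContDiff ℝ n (r j)) →
      ∀ A : ℝ, 0 ≤ A →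
        (∀ j (w : List ι), w.length ≤ n → ∀ z ∈ closedBall (0 : EuclideanSpace ℝ ι) 𝒟.R,
          ‖cwd w (r j) z‖ ≤ A) →
        ∀ v : List ι, v.length ≤ n → v.length ≤ 2 → ∀ y, ‖cwd v (𝒟.gR k r) y‖ ≤ C * A := by
  have hM : ∀ j, ∃ M : ℝ, 0 ≤ M ∧ ∀ v : List ι, v.length ≤ 2 →
      ∀ p ∈ (𝒟.T k j).tterms v, ∀ x, |p.1 x| ≤ M := fun j => (𝒟.T k j).exists_coef_bound 2
  choose M hM0 hM using hM
  refine ⟨∑ j, (1 + (Fintype.card ι : ℝ)) ^ 2 * M j, Finset.sum_nonneg fun j _ => by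
    have := hM0 j; positivity, fun n r hr A hA hrA v hvn hv2 y => ?_⟩
  rw [𝒟.cwd_gR k hr v hvn, Finset.sum_mul]
  refine (norm_sum_le _ _).trans (Finset.sum_le_sum fun j _ => ?_)
  refine ((𝒟.T k j).norm_cwd_transfer_le' (hr j) v hvn y).trans ?_
  have hu : ∀ w : List ι, w.length ≤ v.length → ∀ z ∈ (𝒟.T k j).τ '' tsupport (𝒟.T k j).m,
      ‖cwd w (r j) z‖ ≤ A := fun w hw z hz =>
    hrA j w (hw.trans hvn) z (ball_subset_closedBall (𝒟.image_τ k j hz))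
  refine ((𝒟.T k j).sum_tterms_le v hA (hM j v hv2) hu y).trans ?_
  rw [(𝒟.T k j).length_tterms]
  have h1 : ((1 + Fintype.card ι) ^ v.length : ℕ) ≤ (1 + Fintype.card ι) ^ 2 :=
    Nat.pow_le_pow_right (by omega) hv2
  have h2 : (((1 + Fintype.card ι) ^ v.length : ℕ) : ℝ) ≤ (1 + (Fintype.card ι : ℝ)) ^ 2 := by
    exact_mod_cast h1
  have := hM0 j
  calc (((1 + Fintype.card ι) ^ v.length : ℕ) : ℝ) * (M j * A)
      ≤ (1 + (Fintype.card ι : ℝ)) ^ 2 * (M j * A) := mul_le_mul_of_nonneg_right h2 (by positivity)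
    _ = (1 + (Fintype.card ι : ℝ)) ^ 2 * M j * A := by ring

omit [CompleteSpace W] in
/-- The jet of the reconstruction is bounded by the bound of `exists_cwd_gR_bound`. [folklore] -/
theorem norm_jetR_le (k : Fin N) {r : Fin N → EuclideanSpace ℝ ι → W} {B : ℝ} (hB : 0 ≤ B)
    (h : ∀ v : List ι, v.length ≤ 1 → ∀ y, ‖cwd v (𝒟.gR k r) y‖ ≤ B) (y : EuclideanSpace ℝ ι) :
    ‖𝒟.jetR k r y‖ ≤ B := by
  rw [jetR, Prod.norm_mk, max_le_iff]
  refine ⟨by simpa using h [] (by simp) y, (pi_norm_le_iff_of_nonneg hB).2 fun i => h [i] (by simp) y⟩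

omit [CompleteSpace W] in
/-- Sup bounds of `α_k` and its derivatives of order `≤ 2`. [folklore] -/
theorem exists_α_bound (k : Fin N) :
    ∃ M : ℝ, 0 ≤ M ∧ (∀ y, |𝒟.α k y| ≤ M) ∧ (∀ y i, |fderiv ℝ (𝒟.α k) y (bv i)| ≤ M) ∧
      ∀ y i i', |cwd [i, i'] (𝒟.α k) y| ≤ M := by
  obtain ⟨M, hM0, hM⟩ := exists_bound_cwd_of_hasCompactSupport' (𝒟.contDiff_α k)
    (𝒟.hasCompactSupport_α k) 2
  refine ⟨M, hM0, fun y => ?_, fun y i => ?_, fun y i i' => ?_⟩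
  · have := hM [] (by simp) y; simpa [Real.norm_eq_abs] using this
  · have := hM [i] (by simp) y; simpa [Real.norm_eq_abs, cwd_singleton] using this
  · have := hM [i, i'] (by simp) y; simpa [Real.norm_eq_abs] using this

/-! ### The Lipschitz structure of `FopR` -/

omit [DecidableEq ι] [CompleteSpace W] in
/-- A component of a matrix-valued difference is bounded by the norm of the difference.
[folklore] -/
theorem abs_apply_apply_sub_le (b₁ b₂ : ι → ι → ℝ) (i i' : ι) : |b₁ i i' - b₂ i i'| ≤ ‖b₁ - b₂‖ := by
  rw [← Real.norm_eq_abs, show b₁ i i' - b₂ i i' = (b₁ - b₂) i i' from rfl]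
  exact (norm_le_pi_norm ((b₁ - b₂) i) i').trans (norm_le_pi_norm (b₁ - b₂) i)

/-- The bracket of the correction term: `∂ᵢα ∂_{i'}ĝ + ∂_{i'}α ∂ᵢĝ + ∂_{ii'}α ĝ`. [folklore] -/
def Xbr (k : Fin N) (r : Fin N → EuclideanSpace ℝ ι → W) (y : EuclideanSpace ℝ ι) (i i' : ι) : W :=
  (fderiv ℝ (𝒟.α k) y (bv i)) • cwd [i'] (𝒟.gR k r) y +
    (fderiv ℝ (𝒟.α k) y (bv i')) • cwd [i] (𝒟.gR k r) y + (cwd [i, i'] (𝒟.α k) y) • 𝒟.gR k r y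

omit [CompleteSpace W] in
/-- `ellR` through the bracket. [folklore] -/
theorem ellR_eq (k : Fin N) (r : Fin N → EuclideanSpace ℝ ι → W) (y : EuclideanSpace ℝ ι) :
    𝒟.ellR k r y = -(∑ i, ∑ i', 𝒟.a k (y, 𝒟.jetR k r y) i i' • 𝒟.Xbr k r y i i') +
      𝒟.α k y • 𝒟.f k (y, 𝒟.jetR k r y) := rfl

omit [CompleteSpace W] in
/-- Pointwise bound of the jet by the jet quantity `‖gR‖ + Σᵢ ‖∂ᵢ gR‖`. [folklore] -/
theorem norm_jetR_le_add (k : Fin N) (r : Fin N → EuclideanSpace ℝ ι → W) (y : EuclideanSpace ℝ ι) :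
    ‖𝒟.jetR k r y‖ ≤ ‖𝒟.gR k r y‖ + ∑ i, ‖cwd [i] (𝒟.gR k r) y‖ := by
  have h0 : 0 ≤ ∑ i, ‖cwd [i] (𝒟.gR k r) y‖ := Finset.sum_nonneg fun i _ => norm_nonneg _
  rw [jetR, Prod.norm_mk, max_le_iff]
  refine ⟨le_add_of_nonneg_right h0, (pi_norm_le_iff_of_nonneg (by positivity)).2 fun i => ?_⟩
  have h1 : ‖cwd [i] (𝒟.gR k r) y‖ ≤ ∑ i, ‖cwd [i] (𝒟.gR k r) y‖ :=
    Finset.single_le_sum (f := fun i => ‖cwd [i] (𝒟.gR k r) y‖) (fun i _ => norm_nonneg _)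
      (Finset.mem_univ i)
  exact h1.trans (le_add_of_nonneg_left (norm_nonneg _))

omit [CompleteSpace W] in
/-- Sup bound of the bracket. [folklore] -/
theorem norm_Xbr_le (k : Fin N) {r : Fin N → EuclideanSpace ℝ ι → W} {Mα B : ℝ}
    (hα1 : ∀ y i, |fderiv ℝ (𝒟.α k) y (bv i)| ≤ Mα) (hα2 : ∀ y i i', |cwd [i, i'] (𝒟.α k) y| ≤ Mα)
    (h : ∀ v : List ι, v.length ≤ 2 → ∀ y, ‖cwd v (𝒟.gR k r) y‖ ≤ B) (y : EuclideanSpace ℝ ι)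
    (i i' : ι) : ‖𝒟.Xbr k r y i i'‖ ≤ 3 * Mα * B := by
  have h0 : ‖𝒟.gR k r y‖ ≤ B := by simpa using h [] (by simp) y
  have hMα : 0 ≤ Mα := (abs_nonneg _).trans (hα1 y i)
  unfold Xbr
  refine (norm_add_le _ _).trans ((add_le_add ((norm_add_le _ _).trans (add_le_add ?_ ?_)) ?_).trans_eq
    (by ring : Mα * B + Mα * B + Mα * B = 3 * Mα * B))
  · rw [norm_smul, Real.norm_eq_abs]
    exact mul_le_mul (hα1 y i) (h [i'] (by simp) y) (norm_nonneg _) hMα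
  · rw [norm_smul, Real.norm_eq_abs]
    exact mul_le_mul (hα1 y i') (h [i] (by simp) y) (norm_nonneg _) hMα
  · rw [norm_smul, Real.norm_eq_abs]
    exact mul_le_mul (hα2 y i i') h0 (norm_nonneg _) hMα

omit [CompleteSpace W] in
/-- Lipschitz bound of the bracket in the tuple. [folklore] -/
theorem norm_Xbr_sub_le (k : Fin N) {r₁ r₂ : Fin N → EuclideanSpace ℝ ι → W} {Mα : ℝ}
    (hr₁ : ∀ j, ContDiff ℝ 2 (r₁ j)) (hr₂ : ∀ j, ContDiff ℝ 2 (r₂ j))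
    (hα1 : ∀ y i, |fderiv ℝ (𝒟.α k) y (bv i)| ≤ Mα) (hα2 : ∀ y i i', |cwd [i, i'] (𝒟.α k) y| ≤ Mα)
    (y : EuclideanSpace ℝ ι) (i i' : ι) :
    ‖𝒟.Xbr k r₁ y i i' - 𝒟.Xbr k r₂ y i i'‖ ≤
      3 * Mα * (‖𝒟.gR k (r₁ - r₂) y‖ + ∑ i, ‖cwd [i] (𝒟.gR k (r₁ - r₂)) y‖) := by
  set Jn : ℝ := ‖𝒟.gR k (r₁ - r₂) y‖ + ∑ i, ‖cwd [i] (𝒟.gR k (r₁ - r₂)) y‖ with hJn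
  have hMα : 0 ≤ Mα := (abs_nonneg _).trans (hα1 y i)
  have hg : ‖𝒟.gR k r₁ y - 𝒟.gR k r₂ y‖ ≤ Jn := by
    rw [← Pi.sub_apply (𝒟.gR k r₁), ← 𝒟.gR_sub]
    exact le_add_of_nonneg_right (Finset.sum_nonneg fun i _ => norm_nonneg _)
  have hd : ∀ l, ‖cwd [l] (𝒟.gR k r₁) y - cwd [l] (𝒟.gR k r₂) y‖ ≤ Jn := fun l => by
    rw [← Pi.sub_apply (cwd [l] (𝒟.gR k r₁)), ← 𝒟.cwd_gR_sub k hr₁ hr₂ [l] (by simp)]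
    have h1 : ‖cwd [l] (𝒟.gR k (r₁ - r₂)) y‖ ≤ ∑ i, ‖cwd [i] (𝒟.gR k (r₁ - r₂)) y‖ :=
      Finset.single_le_sum (f := fun i => ‖cwd [i] (𝒟.gR k (r₁ - r₂)) y‖) (fun i _ => norm_nonneg _)
        (Finset.mem_univ l)
    exact h1.trans (le_add_of_nonneg_left (norm_nonneg _))
  have he : 𝒟.Xbr k r₁ y i i' - 𝒟.Xbr k r₂ y i i' =
      (fderiv ℝ (𝒟.α k) y (bv i)) • (cwd [i'] (𝒟.gR k r₁) y - cwd [i'] (𝒟.gR k r₂) y) +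
      (fderiv ℝ (𝒟.α k) y (bv i')) • (cwd [i] (𝒟.gR k r₁) y - cwd [i] (𝒟.gR k r₂) y) +
      (cwd [i, i'] (𝒟.α k) y) • (𝒟.gR k r₁ y - 𝒟.gR k r₂ y) := by
    simp only [Xbr, smul_sub]; abel
  rw [he]
  refine (norm_add_le _ _).trans ((add_le_add ((norm_add_le _ _).trans (add_le_add ?_ ?_)) ?_).trans_eq
    (by ring : Mα * Jn + Mα * Jn + Mα * Jn = 3 * Mα * Jn))
  · rw [norm_smul, Real.norm_eq_abs]
    exact mul_le_mul (hα1 y i) (hd i') (norm_nonneg _) hMα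
  · rw [norm_smul, Real.norm_eq_abs]
    exact mul_le_mul (hα1 y i') (hd i) (norm_nonneg _) hMα
  · rw [norm_smul, Real.norm_eq_abs]
    exact mul_le_mul (hα2 y i i') hg (norm_nonneg _) hMα

omit [CompleteSpace W] in
/-- The algebraic decomposition of the difference of the operators. [folklore] -/
theorem FopR_sub_FopR_sub_eq (k : Fin N) {r₁ r₂ : Fin N → EuclideanSpace ℝ ι → W}
    (hr₁ : ∀ j, ContDiff ℝ 2 (r₁ j)) (hr₂ : ∀ j, ContDiff ℝ 2 (r₂ j)) (y : EuclideanSpace ℝ ι) :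
    𝒟.FopR k r₁ y - 𝒟.FopR k r₂ y -
        ∑ i, ∑ i', 𝒟.b k (y, 𝒟.jetR k r₁ y) i i' • cwd [i, i'] (r₁ k - r₂ k) y =
      (∑ i, ∑ i', (𝒟.b k (y, 𝒟.jetR k r₁ y) i i' - 𝒟.b k (y, 𝒟.jetR k r₂ y) i i') •
          cwd [i, i'] (r₂ k) y) + (𝒟.ellR k r₁ y - 𝒟.ellR k r₂ y) := by
  have hsub : ∀ i i', cwd [i, i'] (r₁ k - r₂ k) y = cwd [i, i'] (r₁ k) y - cwd [i, i'] (r₂ k) y :=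
    fun i i' => by rw [cwd_sub_of_le (hr₁ k) (hr₂ k) [i, i'] (by simp)]; rfl
  simp only [FopR, hsub, smul_sub, sub_smul, Finset.sum_sub_distrib]
  abel

omit [CompleteSpace W] in
/-- **The Lipschitz structure of the classical operator.** For every sup bound `A ≥ 0` there is
`C ≥ 0` (depending on the chart data and `A` only) such that for all `C²` tuples `r₁, r₂` whose
derivatives of order `≤ 2` are bounded by `A` on the closed ball of radius `R`, at every point,
`‖FopR k r₁ − FopR k r₂ − Σ b^{ii'}(y, jetR k r₁ y) ∂_{ii'}(r₁ₖ − r₂ₖ)‖ ≤ C (‖gR k D‖ + Σᵢ ‖∂ᵢ gR k D‖)(y)`,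
`D = r₁ − r₂`: the difference of the operators is the frozen principal part applied to the
difference plus terms controlled by the first-order jet of the reconstruction of the difference.
[cite: TaylorPDEIII2011, Ch. 15, §7, proof of Prop. 7.3; Evans2010, §7.1.2] -/
theorem exists_FopR_lipschitz [FiniteDimensional ℝ W] (k : Fin N) {A : ℝ} (hA : 0 ≤ A) :
    ∃ C : ℝ, 0 ≤ C ∧ ∀ r₁ r₂ : Fin N → EuclideanSpace ℝ ι → W,
      (∀ j, ContDiff ℝ 2 (r₁ j)) → (∀ j, ContDiff ℝ 2 (r₂ j)) →
      (∀ j (w : List ι), w.length ≤ 2 → ∀ z ∈ closedBall (0 : EuclideanSpace ℝ ι) 𝒟.R,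
        ‖cwd w (r₁ j) z‖ ≤ A) →
      (∀ j (w : List ι), w.length ≤ 2 → ∀ z ∈ closedBall (0 : EuclideanSpace ℝ ι) 𝒟.R,
        ‖cwd w (r₂ j) z‖ ≤ A) →
      ∀ y, ‖𝒟.FopR k r₁ y - 𝒟.FopR k r₂ y -
          ∑ i, ∑ i', 𝒟.b k (y, 𝒟.jetR k r₁ y) i i' • cwd [i, i'] (r₁ k - r₂ k) y‖ ≤
        C * (‖𝒟.gR k (r₁ - r₂) y‖ + ∑ i, ‖cwd [i] (𝒟.gR k (r₁ - r₂)) y‖) := by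
  -- constants
  obtain ⟨CJ, hCJ0, hCJ⟩ := 𝒟.exists_cwd_gR_bound k
  obtain ⟨Mα, hMα0, hα0, hα1, hα2⟩ := 𝒟.exists_α_bound k
  obtain ⟨Lb, hLb0, hLb, -, hLbL⟩ :=
    exists_bounds_of_contDiff_one ((𝒟.contDiff_b k).of_le (mod_cast le_top)) (max 𝒟.R (CJ * A))
  obtain ⟨Lf, hLf0, -, -, hLfL⟩ :=
    exists_bounds_of_contDiff_one ((𝒟.contDiff_f k).of_le (mod_cast le_top)) (max 𝒟.R (CJ * A))
  refine ⟨(Fintype.card ι : ℝ) ^ 2 * (Lb * A) +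
      ((Fintype.card ι : ℝ) ^ 2 * (Lb * (3 * Mα * (CJ * A)) + (1 + Lb) * (3 * Mα)) + Mα * Lf),
    by positivity, fun r₁ r₂ hr₁ hr₂ hA₁ hA₂ y => ?_⟩
  set Jn : ℝ := ‖𝒟.gR k (r₁ - r₂) y‖ + ∑ i, ‖cwd [i] (𝒟.gR k (r₁ - r₂)) y‖ with hJn
  have hJn0 : 0 ≤ Jn := by positivity
  by_cases hy : 𝒟.R ≤ ‖y‖
  · -- outside the ball everything vanishes
    rw [𝒟.FopR_eq_zero k r₁ hy, 𝒟.FopR_eq_zero k r₂ hy]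
    simp only [𝒟.b_eq_zero k y _ hy, Pi.zero_apply, zero_smul, Finset.sum_const_zero, sub_zero,
      norm_zero]
    positivity
  have hyR : ‖y‖ ≤ 𝒟.R := (not_le.1 hy).le
  -- uniform jet bounds and membership in the compact jet region
  have hJ : ∀ r : Fin N → EuclideanSpace ℝ ι → W, (∀ j, ContDiff ℝ 2 (r j)) →
      (∀ j (w : List ι), w.length ≤ 2 → ∀ z ∈ closedBall (0 : EuclideanSpace ℝ ι) 𝒟.R,
        ‖cwd w (r j) z‖ ≤ A) →
      ∀ v : List ι, v.length ≤ 2 → ∀ y, ‖cwd v (𝒟.gR k r) y‖ ≤ CJ * A :=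
    fun r hr hrA v hv y => hCJ 2 r hr A hA hrA v hv hv y
  have hz : ∀ r : Fin N → EuclideanSpace ℝ ι → W,
      (∀ v : List ι, v.length ≤ 2 → ∀ y, ‖cwd v (𝒟.gR k r) y‖ ≤ CJ * A) →
      (y, 𝒟.jetR k r y) ∈ closedBall (0 : EuclideanSpace ℝ ι × (W × (ι → W))) (max 𝒟.R (CJ * A)) :=
    fun r hr => by
      rw [mem_closedBall, dist_zero_right, Prod.norm_mk, max_le_iff]
      exact ⟨hyR.trans (le_max_left _ _), (𝒟.norm_jetR_le k (by positivity)
        (fun v hv y => hr v (by omega) y) y).trans (le_max_right _ _)⟩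
  have hJ₁ := hJ r₁ hr₁ hA₁
  have hJ₂ := hJ r₂ hr₂ hA₂
  have hz₁ := hz r₁ hJ₁
  have hz₂ := hz r₂ hJ₂
  -- the jet difference is controlled by `Jn`
  have hzd : ‖(y, 𝒟.jetR k r₁ y) - (y, 𝒟.jetR k r₂ y)‖ ≤ Jn := by
    rw [Prod.mk_sub_mk, sub_self, Prod.norm_mk, norm_zero, max_eq_right (norm_nonneg _),
      ← 𝒟.jetR_sub k hr₁ hr₂ (by norm_num) y]
    exact 𝒟.norm_jetR_le_add k (r₁ - r₂) y
  -- Lipschitz and sup consequences for the coefficients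
  have hbd : ‖𝒟.b k (y, 𝒟.jetR k r₁ y) - 𝒟.b k (y, 𝒟.jetR k r₂ y)‖ ≤ Lb * Jn :=
    (hLbL _ hz₁ _ hz₂).trans (mul_le_mul_of_nonneg_left hzd hLb0)
  have hbii : ∀ i i', |𝒟.b k (y, 𝒟.jetR k r₁ y) i i' - 𝒟.b k (y, 𝒟.jetR k r₂ y) i i'| ≤ Lb * Jn :=
    fun i i' => (abs_apply_apply_sub_le _ _ i i').trans hbd
  have haii : ∀ i i', |𝒟.a k (y, 𝒟.jetR k r₁ y) i i' - 𝒟.a k (y, 𝒟.jetR k r₂ y) i i'| ≤ Lb * Jn :=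
    fun i i' => by
      have : 𝒟.a k (y, 𝒟.jetR k r₁ y) i i' - 𝒟.a k (y, 𝒟.jetR k r₂ y) i i' =
          𝒟.b k (y, 𝒟.jetR k r₁ y) i i' - 𝒟.b k (y, 𝒟.jetR k r₂ y) i i' := by
        simp only [a]; ring
      rw [this]; exact hbii i i'
  have ha2 : ∀ i i', |𝒟.a k (y, 𝒟.jetR k r₂ y) i i'| ≤ 1 + Lb := fun i i' => by
    have h1 : |𝒟.b k (y, 𝒟.jetR k r₂ y) i i'| ≤ Lb := by
      have := abs_apply_apply_sub_le (𝒟.b k (y, 𝒟.jetR k r₂ y)) 0 i i'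
      simp only [Pi.zero_apply, sub_zero] at this
      exact this.trans (hLb _ hz₂)
    have h2 : |(if i = i' then (1 : ℝ) else 0)| ≤ 1 := by split_ifs <;> simp
    exact (abs_add_le _ _).trans (add_le_add h2 h1)
  have hfd : ‖𝒟.f k (y, 𝒟.jetR k r₁ y) - 𝒟.f k (y, 𝒟.jetR k r₂ y)‖ ≤ Lf * Jn :=
    (hLfL _ hz₁ _ hz₂).trans (mul_le_mul_of_nonneg_left hzd hLf0)
  have hY₂ : ∀ i i', ‖cwd [i, i'] (r₂ k) y‖ ≤ A := fun i i' =>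
    hA₂ k [i, i'] (by simp) y (by rw [mem_closedBall, dist_zero_right]; exact hyR)
  -- the three pieces
  have hP1 : ‖∑ i, ∑ i', (𝒟.b k (y, 𝒟.jetR k r₁ y) i i' - 𝒟.b k (y, 𝒟.jetR k r₂ y) i i') •
      cwd [i, i'] (r₂ k) y‖ ≤ (Fintype.card ι : ℝ) ^ 2 * (Lb * Jn * A) := by
    refine (norm_sum_le _ _).trans ((Finset.sum_le_sum fun i _ => norm_sum_le _ _).trans
      (sum_sum_le_card_sq_mul fun i i' => ?_))
    rw [norm_smul, Real.norm_eq_abs]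
    exact mul_le_mul (hbii i i') (hY₂ i i') (norm_nonneg _) (by positivity)
  have hP2 : ‖(∑ i, ∑ i', 𝒟.a k (y, 𝒟.jetR k r₁ y) i i' • 𝒟.Xbr k r₁ y i i') -
      ∑ i, ∑ i', 𝒟.a k (y, 𝒟.jetR k r₂ y) i i' • 𝒟.Xbr k r₂ y i i'‖ ≤
      (Fintype.card ι : ℝ) ^ 2 * (Lb * Jn * (3 * Mα * (CJ * A)) + (1 + Lb) * (3 * Mα * Jn)) := by
    refine (norm_sum_sum_smul_sub_le _ _ _ _).trans (sum_sum_le_card_sq_mul fun i i' => ?_)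
    refine add_le_add (mul_le_mul (haii i i') (𝒟.norm_Xbr_le k hα1 hα2 hJ₁ y i i')
      (norm_nonneg _) (by positivity)) (mul_le_mul (ha2 i i')
      (𝒟.norm_Xbr_sub_le k hr₁ hr₂ hα1 hα2 y i i') (norm_nonneg _) (by positivity))
  have hP3 : ‖𝒟.α k y • (𝒟.f k (y, 𝒟.jetR k r₁ y) - 𝒟.f k (y, 𝒟.jetR k r₂ y))‖ ≤ Mα * (Lf * Jn) := by
    rw [norm_smul, Real.norm_eq_abs]
    exact mul_le_mul (hα0 y) hfd (norm_nonneg _) hMα0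
  -- assemble
  rw [𝒟.FopR_sub_FopR_sub_eq k hr₁ hr₂ y, 𝒟.ellR_eq, 𝒟.ellR_eq]
  have he : -(∑ i, ∑ i', 𝒟.a k (y, 𝒟.jetR k r₁ y) i i' • 𝒟.Xbr k r₁ y i i') +
        𝒟.α k y • 𝒟.f k (y, 𝒟.jetR k r₁ y) -
      (-(∑ i, ∑ i', 𝒟.a k (y, 𝒟.jetR k r₂ y) i i' • 𝒟.Xbr k r₂ y i i') +
        𝒟.α k y • 𝒟.f k (y, 𝒟.jetR k r₂ y)) =
      -((∑ i, ∑ i', 𝒟.a k (y, 𝒟.jetR k r₁ y) i i' • 𝒟.Xbr k r₁ y i i') -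
        ∑ i, ∑ i', 𝒟.a k (y, 𝒟.jetR k r₂ y) i i' • 𝒟.Xbr k r₂ y i i') +
      𝒟.α k y • (𝒟.f k (y, 𝒟.jetR k r₁ y) - 𝒟.f k (y, 𝒟.jetR k r₂ y)) := by
    rw [smul_sub]; abel
  rw [he]
  refine (norm_add_le _ _).trans ((add_le_add hP1 ((norm_add_le _ _).trans (add_le_add
    ((norm_neg _).trans_le hP2) hP3))).trans (le_of_eq ?_))
  ring


/-! ### The frozen principal coefficient -/

omit [CompleteSpace W] in
/-- The derivative of the jet along a frame vector, and its bound. [folklore] -/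
theorem hasFDerivAt_jetR (k : Fin N) {r : Fin N → EuclideanSpace ℝ ι → W} (hr : ∀ j, ContDiff ℝ 2 (r j))
    (y : EuclideanSpace ℝ ι) :
    HasFDerivAt (𝒟.jetR k r) ((fderiv ℝ (𝒟.gR k r) y).prod
      (ContinuousLinearMap.pi fun i => fderiv ℝ (cwd [i] (𝒟.gR k r)) y)) y := by
  have hg : ContDiff ℝ 2 (𝒟.gR k r) := 𝒟.contDiff_gR k hr
  have h1 : HasFDerivAt (𝒟.gR k r) (fderiv ℝ (𝒟.gR k r) y) y :=
    ((hg.differentiable (by norm_num)) y).hasFDerivAt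
  have h2 : ∀ i, HasFDerivAt (cwd [i] (𝒟.gR k r)) (fderiv ℝ (cwd [i] (𝒟.gR k r)) y) y := fun i =>
    ((differentiable_cwd_of_le hg [i] (by simp)) y).hasFDerivAt
  exact h1.prodMk (hasFDerivAt_pi.2 h2)

omit [CompleteSpace W] in
/-- `‖D(jetR)(y) bv_l‖ ≤ B` when all word derivatives of order `≤ 2` of `gR` are bounded by `B`.
[folklore] -/
theorem norm_fderiv_jetR_le (k : Fin N) {r : Fin N → EuclideanSpace ℝ ι → W} (hr : ∀ j, ContDiff ℝ 2 (r j))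
    {B : ℝ} (hB : 0 ≤ B) (h : ∀ v : List ι, v.length ≤ 2 → ∀ y, ‖cwd v (𝒟.gR k r) y‖ ≤ B)
    (y : EuclideanSpace ℝ ι) (l : ι) : ‖fderiv ℝ (𝒟.jetR k r) y (bv l)‖ ≤ B := by
  rw [(𝒟.hasFDerivAt_jetR k hr y).fderiv, ContinuousLinearMap.prod_apply, Prod.norm_mk, max_le_iff]
  refine ⟨h [l] (by simp) y, (pi_norm_le_iff_of_nonneg hB).2 fun i => ?_⟩
  rw [ContinuousLinearMap.pi_apply]
  exact h [l, i] (by simp) y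

omit [CompleteSpace W] in
/-- **The frozen principal coefficient** `y ↦ a_k(y, jetR k r y)` of a `C²` tuple with
derivatives of order `≤ 2` bounded by `A` on the ball: it is `C¹`, bounded, with bounded frame
derivatives, the bounds depending on the chart data and `A` only (and it is uniformly elliptic by
`a_elliptic`). [cite: Evans2010, §7.1.2; TaylorPDEIII2011, Ch. 15, §7] -/
theorem exists_aField_bounds [FiniteDimensional ℝ W] (k : Fin N) {A : ℝ} (hA : 0 ≤ A) :
    ∃ M : ℝ, 0 ≤ M ∧ ∀ r : Fin N → EuclideanSpace ℝ ι → W, (∀ j, ContDiff ℝ 2 (r j)) →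
      (∀ j (w : List ι), w.length ≤ 2 → ∀ z ∈ closedBall (0 : EuclideanSpace ℝ ι) 𝒟.R,
        ‖cwd w (r j) z‖ ≤ A) →
      (∀ i i', ContDiff ℝ 1 fun y => 𝒟.a k (y, 𝒟.jetR k r y) i i') ∧
      (∀ y i i', |𝒟.a k (y, 𝒟.jetR k r y) i i'| ≤ M) ∧
      ∀ y i i' l, |fderiv ℝ (fun y => 𝒟.a k (y, 𝒟.jetR k r y) i i') y (bv l)| ≤ M := by
  obtain ⟨CJ, hCJ0, hCJ⟩ := 𝒟.exists_cwd_gR_bound k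
  obtain ⟨Lb, hLb0, hLb, hLb', -⟩ :=
    exists_bounds_of_contDiff_one ((𝒟.contDiff_b k).of_le (mod_cast le_top)) (max 𝒟.R (CJ * A))
  refine ⟨max (1 + Lb) (Lb * max 1 (CJ * A)), by positivity, fun r hr hrA => ?_⟩
  have hJ : ∀ v : List ι, v.length ≤ 2 → ∀ y, ‖cwd v (𝒟.gR k r) y‖ ≤ CJ * A :=
    fun v hv y => hCJ 2 r hr A hA hrA v hv hv y
  -- regularity
  have hg : ContDiff ℝ 2 (𝒟.gR k r) := 𝒟.contDiff_gR k hr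
  have hjet : ContDiff ℝ 1 (𝒟.jetR k r) := by
    refine (hg.of_le (by norm_num)).prodMk (contDiff_pi.2 fun i => ?_)
    exact contDiff_cwd_of_le hg [i] 1 (by simp)
  have hzC : ContDiff ℝ 1 fun y => (y, 𝒟.jetR k r y) := contDiff_id.prodMk hjet
  have hbC : ContDiff ℝ 1 fun y => 𝒟.b k (y, 𝒟.jetR k r y) :=
    ((𝒟.contDiff_b k).of_le (mod_cast le_top)).comp hzC
  have hbC' : ∀ i i', ContDiff ℝ 1 fun y => 𝒟.b k (y, 𝒟.jetR k r y) i i' := fun i i' =>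
    contDiff_pi.1 (contDiff_pi.1 hbC i) i'
  have haC : ∀ i i', ContDiff ℝ 1 fun y => 𝒟.a k (y, 𝒟.jetR k r y) i i' := fun i i' => by
    simp only [a]
    exact contDiff_const.add (hbC' i i')
  -- membership in the jet region inside the ball
  have hz : ∀ y, ‖y‖ ≤ 𝒟.R →
      (y, 𝒟.jetR k r y) ∈ closedBall (0 : EuclideanSpace ℝ ι × (W × (ι → W))) (max 𝒟.R (CJ * A)) :=
    fun y hyR => by
      rw [mem_closedBall, dist_zero_right, Prod.norm_mk, max_le_iff]
      exact ⟨hyR.trans (le_max_left _ _), (𝒟.norm_jetR_le k (by positivity)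
        (fun v hv y => hJ v (by omega) y) y).trans (le_max_right _ _)⟩
  refine ⟨haC, fun y i i' => ?_, fun y i i' l => ?_⟩
  · -- value bound
    refine le_trans ?_ (le_max_left _ _)
    have h2 : |(if i = i' then (1 : ℝ) else 0)| ≤ 1 := by split_ifs <;> simp
    have h1 : |𝒟.b k (y, 𝒟.jetR k r y) i i'| ≤ Lb := by
      by_cases hy : 𝒟.R ≤ ‖y‖
      · rw [𝒟.b_eq_zero k y _ hy]; simpa using hLb0
      · have := abs_apply_apply_sub_le (𝒟.b k (y, 𝒟.jetR k r y)) 0 i i'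
        simp only [Pi.zero_apply, sub_zero] at this
        exact this.trans (hLb _ (hz y (not_le.1 hy).le))
    simp only [a]
    exact (abs_add_le _ _).trans (add_le_add h2 h1)
  · -- derivative bound
    refine le_trans ?_ (le_max_right _ _)
    have hδ : fderiv ℝ (fun y => 𝒟.a k (y, 𝒟.jetR k r y) i i') y =
        fderiv ℝ (fun y => 𝒟.b k (y, 𝒟.jetR k r y) i i') y := by
      simp only [a]
      exact fderiv_const_add _
    rw [hδ]
    by_cases hy : 𝒟.R < ‖y‖
    · -- outside the closed ball the coefficient vanishes near `y`
      have hev : (fun y => 𝒟.b k (y, 𝒟.jetR k r y) i i') =ᶠ[𝓝 y] fun _ => 0 := by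
        have ho : IsOpen {y : EuclideanSpace ℝ ι | 𝒟.R < ‖y‖} := isOpen_lt continuous_const continuous_norm
        filter_upwards [ho.mem_nhds hy] with y' hy'
        rw [𝒟.b_eq_zero k y' _ (le_of_lt hy')]; rfl
      rw [hev.fderiv_eq, fderiv_const_apply]
      simp only [zero_apply, abs_zero]
      positivity
    · have hyR : ‖y‖ ≤ 𝒟.R := not_lt.1 hy
      -- chain rule
      have hjd := 𝒟.hasFDerivAt_jetR k hr y
      have hzd : HasFDerivAt (fun y => (y, 𝒟.jetR k r y))
          ((ContinuousLinearMap.id ℝ _).prod ((fderiv ℝ (𝒟.gR k r) y).prod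
            (ContinuousLinearMap.pi fun i => fderiv ℝ (cwd [i] (𝒟.gR k r)) y))) y :=
        (hasFDerivAt_id y).prodMk hjd
      have hbd : HasFDerivAt (𝒟.b k) (fderiv ℝ (𝒟.b k) (y, 𝒟.jetR k r y)) (y, 𝒟.jetR k r y) :=
        (((𝒟.contDiff_b k).differentiable (by simp)) _).hasFDerivAt
      have hcomp := hbd.comp y hzd
      set P : (ι → ι → ℝ) →L[ℝ] ℝ := (ContinuousLinearMap.proj (R := ℝ) (φ := fun _ : ι => ℝ) i').comp
        (ContinuousLinearMap.proj (R := ℝ) (φ := fun _ : ι => ι → ℝ) i) with hP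
      have hfull := P.hasFDerivAt.comp y hcomp
      have heq : (P ∘ (𝒟.b k ∘ fun y => (y, 𝒟.jetR k r y))) = fun y => 𝒟.b k (y, 𝒟.jetR k r y) i i' := rfl
      rw [heq] at hfull
      rw [hfull.fderiv]
      simp only [ContinuousLinearMap.comp_apply, hP, ContinuousLinearMap.proj_apply]
      -- bound of the full derivative applied to `bv l`
      set v := ((ContinuousLinearMap.id ℝ _).prod ((fderiv ℝ (𝒟.gR k r) y).prod
            (ContinuousLinearMap.pi fun i => fderiv ℝ (cwd [i] (𝒟.gR k r)) y))) (bv l) with hv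
      have hvn : ‖v‖ ≤ max 1 (CJ * A) := by
        rw [hv, ContinuousLinearMap.prod_apply, Prod.norm_mk, ContinuousLinearMap.id_apply, norm_bv]
        refine max_le_max le_rfl ?_
        have := 𝒟.norm_fderiv_jetR_le k hr (by positivity) hJ y l
        rwa [hjd.fderiv] at this
      have h1 : |(fderiv ℝ (𝒟.b k) (y, 𝒟.jetR k r y) v) i i'| ≤ ‖fderiv ℝ (𝒟.b k) (y, 𝒟.jetR k r y) v‖ := by
        rw [← Real.norm_eq_abs]
        exact (norm_le_pi_norm ((fderiv ℝ (𝒟.b k) (y, 𝒟.jetR k r y) v) i) i').trans (norm_le_pi_norm _ i)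
      refine h1.trans ((ContinuousLinearMap.le_opNorm _ _).trans ?_)
      exact mul_le_mul (hLb' _ (hz y hyR)) hvn (norm_nonneg _) hLb0

/-! ### The `L²` bound of the jet quantity -/

omit [DecidableEq ι] [CompleteSpace W] in
/-- Pointwise domination with a multiplier supported in `K`: `‖𝟙_B (c • h)‖_{L²} ≤ M ‖𝟙_K h‖_{L²}`.
[folklore] -/
theorem l2On_smul_le_of_support {K B : Set (EuclideanSpace ℝ ι)} {c : EuclideanSpace ℝ ι → ℝ} {M : ℝ}
    (hM : 0 ≤ M) (hc : ∀ x, |c x| ≤ M) (hcK : support c ⊆ K) {h : EuclideanSpace ℝ ι → W}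
    (hfin : eLpNorm (K.indicator h) 2 (volume : Measure (EuclideanSpace ℝ ι)) ≠ ⊤) :
    l2On B (fun x => c x • h x) ≤ M * l2On K h := by
  rw [l2On_def, l2On_def]
  have hpt : ∀ x, ‖B.indicator (fun x => c x • h x) x‖ ≤ M * ‖K.indicator h x‖ := fun x => by
    by_cases hxK : x ∈ K
    · rw [indicator_of_mem hxK]
      refine (norm_indicator_le_norm_self _ _).trans ?_
      rw [norm_smul, Real.norm_eq_abs]
      exact mul_le_mul_of_nonneg_right (hc x) (norm_nonneg _)
    · have h0 : c x = 0 := by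
        by_contra h; exact hxK (hcK (mem_support.2 h))
      have : B.indicator (fun x => c x • h x) x = 0 := by
        by_cases hxB : x ∈ B
        · rw [indicator_of_mem hxB, h0, zero_smul]
        · rw [indicator_of_notMem hxB]
      rw [this, norm_zero]; positivity
  have h1 := eLpNorm_le_mul_eLpNorm_of_ae_le_mul (p := (2 : ℝ≥0∞))
    (μ := (volume : Measure (EuclideanSpace ℝ ι))) (Eventually.of_forall hpt)
  calc (eLpNorm (B.indicator fun x => c x • h x) 2 volume).toReal
      ≤ (ENNReal.ofReal M * eLpNorm (K.indicator h) 2 volume).toReal :=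
        ENNReal.toReal_mono (ENNReal.mul_ne_top ENNReal.ofReal_ne_top hfin) h1
    _ = M * (eLpNorm (K.indicator h) 2 volume).toReal := by
        rw [ENNReal.toReal_mul, ENNReal.toReal_ofReal hM]

omit [CompleteSpace W] in
/-- The `L²` bound of one chain-rule term of the transfer of an `L²` derivative. [folklore] -/
theorem l2On_tterm_le (k j : Fin N) {D : Fin N → EuclideanSpace ℝ ι → W} {v : List ι}
    {p : (EuclideanSpace ℝ ι → ℝ) × List ι} (hp : p ∈ (𝒟.T k j).tterms v) {M : ℝ} (hM : 0 ≤ M)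
    (hMp : ∀ x, |p.1 x| ≤ M) (hh : MemLp (cwd p.2 (D j)) 2 (volume : Measure (EuclideanSpace ℝ ι)))
    {δ : ℝ} (hδ : 0 < δ) (hδle : ∀ x ∈ tsupport (𝒟.T k j).m, δ ≤ |(fderiv ℝ (𝒟.T k j).τ x).det|)
    (B : Set (EuclideanSpace ℝ ι)) :
    l2On B (fun x => p.1 x • cwd p.2 (D j) ((𝒟.T k j).τ x)) ≤
      M * ((δ ^ (2 : ℝ)⁻¹)⁻¹ * (eLpNorm (cwd p.2 (D j)) 2 (volume : Measure (EuclideanSpace ℝ ι))).toReal) := by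
  have hsupp : support p.1 ⊆ tsupport (𝒟.T k j).m :=
    (subset_tsupport _).trans ((𝒟.T k j).tterms_spec v p hp).2.1
  have hfin : eLpNorm ((tsupport (𝒟.T k j).m).indicator fun x => cwd p.2 (D j) ((𝒟.T k j).τ x)) 2
      (volume : Measure (EuclideanSpace ℝ ι)) ≠ ⊤ := by
    refine ne_top_of_le_ne_top ?_ ((𝒟.T k j).eLpNorm_indicator_comp_le (cwd p.2 (D j)) hδ hδle)
    refine ENNReal.mul_ne_top ?_ hh.eLpNorm_ne_top
    refine (ENNReal.rpow_lt_top_of_nonneg (by norm_num) ?_).ne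
    exact ENNReal.inv_ne_top.2 (by simpa using hδ)
  refine (l2On_smul_le_of_support hM hMp hsupp hfin).trans ?_
  exact mul_le_mul_of_nonneg_left ((𝒟.T k j).l2On_comp_le hh hδ hδle) hM

omit [CompleteSpace W] in
/-- **The `L²` bound of the jet quantity of a `C¹ ∩ H¹` tuple on the ball**:
`‖𝟙_B (‖gR k D‖ + Σᵢ ‖∂ᵢ gR k D‖)‖_{L²} ≤ C Σ_j (‖D_j‖_{L²} + Σ_l ‖∂_l D_j‖_{L²})`.
[cite: Adams1975, Thm. 3.35] -/
theorem exists_l2On_jet_le (k : Fin N) :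
    ∃ C : ℝ, 0 ≤ C ∧ ∀ D : Fin N → EuclideanSpace ℝ ι → W, (∀ j, ContDiff ℝ 1 (D j)) →
      (∀ j, MemLp (D j) 2 (volume : Measure (EuclideanSpace ℝ ι))) →
      (∀ j l, MemLp (cwd [l] (D j)) 2 (volume : Measure (EuclideanSpace ℝ ι))) →
      l2On (closedBall (0 : EuclideanSpace ℝ ι) 𝒟.R)
          (fun y => ‖𝒟.gR k D y‖ + ∑ i, ‖cwd [i] (𝒟.gR k D) y‖) ≤
        C * ∑ j, ((eLpNorm (D j) 2 (volume : Measure (EuclideanSpace ℝ ι))).toReal +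
          ∑ l, (eLpNorm (cwd [l] (D j)) 2 (volume : Measure (EuclideanSpace ℝ ι))).toReal) := by
  -- constants per chart
  have hM : ∀ j, ∃ M : ℝ, 0 ≤ M ∧ ∀ v : List ι, v.length ≤ 1 →
      ∀ p ∈ (𝒟.T k j).tterms v, ∀ x, |p.1 x| ≤ M := fun j => (𝒟.T k j).exists_coef_bound 1
  choose M hM0 hM using hM
  have hδ : ∀ j, ∃ δ : ℝ, 0 < δ ∧ ∀ x ∈ tsupport (𝒟.T k j).m, δ ≤ |(fderiv ℝ (𝒟.T k j).τ x).det| :=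
    fun j => (𝒟.T k j).exists_det_lower_bound
  choose δ hδ0 hδ using hδ
  set C₁ : ℝ := ∑ j, (1 + (Fintype.card ι : ℝ)) * (M j * (δ j ^ (2 : ℝ)⁻¹)⁻¹) with hC₁
  have hC₁0 : 0 ≤ C₁ := Finset.sum_nonneg fun j _ => by
    have := hM0 j; have := hδ0 j; positivity
  have hC₁j : ∀ j, (1 + (Fintype.card ι : ℝ)) * (M j * (δ j ^ (2 : ℝ)⁻¹)⁻¹) ≤ C₁ := fun j =>
    Finset.single_le_sum (f := fun j => (1 + (Fintype.card ι : ℝ)) * (M j * (δ j ^ (2 : ℝ)⁻¹)⁻¹))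
      (fun j _ => by have := hM0 j; have := hδ0 j; positivity) (Finset.mem_univ j)
  refine ⟨(1 + (Fintype.card ι : ℝ)) * C₁, by positivity, fun D hD hD2 hDl2 => ?_⟩
  set B := closedBall (0 : EuclideanSpace ℝ ι) 𝒟.R with hB
  have hBc : IsCompact B := isCompact_closedBall 0 𝒟.R
  set Y : Fin N → ℝ := fun j => (eLpNorm (D j) 2 (volume : Measure (EuclideanSpace ℝ ι))).toReal +
      ∑ l, (eLpNorm (cwd [l] (D j)) 2 (volume : Measure (EuclideanSpace ℝ ι))).toReal with hY
  have hY0 : ∀ j, 0 ≤ Y j := fun j => by positivity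
  -- `L²` data of the words of length `≤ 1`
  have hw : ∀ j (w : List ι), w.length ≤ 1 →
      MemLp (cwd w (D j)) 2 (volume : Measure (EuclideanSpace ℝ ι)) ∧
        (eLpNorm (cwd w (D j)) 2 (volume : Measure (EuclideanSpace ℝ ι))).toReal ≤ Y j := by
    intro j w hw
    match w, hw with
    | [], _ =>
      refine ⟨by simpa using hD2 j, ?_⟩
      simp only [cwd_nil, hY]
      exact le_add_of_nonneg_right (Finset.sum_nonneg fun l _ => ENNReal.toReal_nonneg)
    | [l], _ =>
      refine ⟨hDl2 j l, ?_⟩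
      simp only [hY]
      have h1 : (eLpNorm (cwd [l] (D j)) 2 (volume : Measure (EuclideanSpace ℝ ι))).toReal ≤
          ∑ l, (eLpNorm (cwd [l] (D j)) 2 (volume : Measure (EuclideanSpace ℝ ι))).toReal :=
        Finset.single_le_sum (f := fun l => (eLpNorm (cwd [l] (D j)) 2
          (volume : Measure (EuclideanSpace ℝ ι))).toReal) (fun l _ => ENNReal.toReal_nonneg)
          (Finset.mem_univ l)
      exact h1.trans (le_add_of_nonneg_left ENNReal.toReal_nonneg)
    | _ :: _ :: _, h => simp at h
  -- the bound for one word of length `≤ 1`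
  have hword : ∀ v : List ι, v.length ≤ 1 → l2On B (cwd v (𝒟.gR k D)) ≤ C₁ * ∑ j, Y j := by
    intro v hv
    rw [𝒟.cwd_gR k hD v hv, Finset.mul_sum]
    refine (l2On_finset_sum_le hBc Finset.univ fun j _ => ?_).trans (Finset.sum_le_sum fun j _ => ?_)
    · exact continuous_cwd_of_le ((𝒟.T k j).contDiff_transfer_nat (hD j)) v hv
    rw [(𝒟.T k j).cwd_transfer_of_contDiff (hD j) v hv]
    refine (l2On_list_sum_le hBc _ fun p hp => (𝒟.T k j).continuous_tterm (hD j) hv hp).trans ?_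
    have hterm : ∀ p ∈ (𝒟.T k j).tterms v,
        l2On B (fun x => p.1 x • cwd p.2 (D j) ((𝒟.T k j).τ x)) ≤ M j * ((δ j ^ (2 : ℝ)⁻¹)⁻¹ * Y j) := by
      intro p hp
      have hp2 : p.2.length ≤ 1 := ((𝒟.T k j).tterms_spec v p hp).2.2.trans hv
      refine (𝒟.l2On_tterm_le k j hp (hM0 j) (hM j v hv p hp) (hw j p.2 hp2).1 (hδ0 j) (hδ j) B).trans ?_
      have := hM0 j; have := hδ0 j
      exact mul_le_mul_of_nonneg_left (mul_le_mul_of_nonneg_left (hw j p.2 hp2).2 (by positivity)) (hM0 j)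
    have hsum := List.sum_le_card_nsmul (((𝒟.T k j).tterms v).map
      (fun p => l2On B fun x => p.1 x • cwd p.2 (D j) ((𝒟.T k j).τ x))) (M j * ((δ j ^ (2 : ℝ)⁻¹)⁻¹ * Y j))
      (fun y hy => by
        obtain ⟨p, hp, rfl⟩ := List.mem_map.1 hy
        exact hterm p hp)
    refine hsum.trans ?_
    rw [List.length_map, (𝒟.T k j).length_tterms, nsmul_eq_mul]
    have h1 : (((1 + Fintype.card ι) ^ v.length : ℕ) : ℝ) ≤ 1 + (Fintype.card ι : ℝ) := by
      have : ((1 + Fintype.card ι) ^ v.length : ℕ) ≤ (1 + Fintype.card ι) ^ 1 :=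
        Nat.pow_le_pow_right (by omega) hv
      rw [pow_one] at this
      exact_mod_cast this
    have := hM0 j; have := hδ0 j; have := hY0 j
    calc (((1 + Fintype.card ι) ^ v.length : ℕ) : ℝ) * (M j * ((δ j ^ (2 : ℝ)⁻¹)⁻¹ * Y j))
        ≤ (1 + (Fintype.card ι : ℝ)) * (M j * ((δ j ^ (2 : ℝ)⁻¹)⁻¹ * Y j)) :=
          mul_le_mul_of_nonneg_right h1 (by positivity)
      _ = (1 + (Fintype.card ι : ℝ)) * (M j * (δ j ^ (2 : ℝ)⁻¹)⁻¹) * Y j := by ring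
      _ ≤ C₁ * Y j := mul_le_mul_of_nonneg_right (hC₁j j) (hY0 j)
  -- sum over the components of the jet quantity
  have hg1 : ContDiff ℝ 1 (𝒟.gR k D) := 𝒟.contDiff_gR k hD
  have hc0 : Continuous (𝒟.gR k D) := hg1.continuous
  have hc1 : ∀ i, Continuous (cwd [i] (𝒟.gR k D)) := fun i => continuous_cwd_of_le hg1 [i] (by simp)
  have hS0 : 0 ≤ ∑ j, Y j := Finset.sum_nonneg fun j _ => hY0 j
  calc l2On B (fun y => ‖𝒟.gR k D y‖ + ∑ i, ‖cwd [i] (𝒟.gR k D) y‖)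
      ≤ l2On B (fun y => ‖𝒟.gR k D y‖) + l2On B (fun y => ∑ i, ‖cwd [i] (𝒟.gR k D) y‖) :=
        l2On_add_le hBc hc0.norm (continuous_finsetSum _ fun i _ => (hc1 i).norm)
    _ ≤ l2On B (𝒟.gR k D) + ∑ i, l2On B (cwd [i] (𝒟.gR k D)) := by
        rw [l2On_norm]
        refine add_le_add le_rfl ((l2On_finset_sum_le hBc Finset.univ fun i _ => (hc1 i).norm).trans
          (le_of_eq (Finset.sum_congr rfl fun i _ => l2On_norm _ _)))
    _ ≤ C₁ * ∑ j, Y j + ∑ _i : ι, C₁ * ∑ j, Y j := by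
        refine add_le_add (by simpa using hword [] (by simp)) (Finset.sum_le_sum fun i _ => hword [i] (by simp))
    _ = (1 + (Fintype.card ι : ℝ)) * C₁ * ∑ j, Y j := by
        simp only [Finset.sum_const, Finset.card_univ, nsmul_eq_mul]; ring

end ChartData

end Literature.Analysis.PDE

end
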